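import Mathlib
import HarnessLib
import Literature.NumberTheory.LFunctions.ZetaScrew
import Literature.NumberTheory.LFunctions.WeilSmallSupportPositivity
import Literature.NumberTheory.LFunctions.UniformWeilPositivityRH
import Summits.RiemannHypothesis.RiemannHypothesis.Theorems.IntegerScrewWeilWindowConverse
import Summits.RiemannHypothesis.RiemannHypothesis.Theorems.IntegerScrewWeilWindowCoerciveComb

/-!
# Route `IntegerScrew` — an RH-FREE COERCIVE floor on balanced windows of the integer screw matrices
# from `L²`-coercivity of Weil's form (Bombieri's Theorem 12): `c(L)/(4M)·Σ x_m² ≤ Σ G(log m, log m') x_m x_{m'}`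

For a window `(N, M]` of log-length `L = log M − log(N+1) < 2a` and a balanced real vector `x`, the
recentred nodes `log m − c₀` (`c₀` the midpoint) form a zero-sum configuration in `(−a, a)` whose step
function `P` is the partial-sum sequence `S_m = Σ_{N<k≤m} x_k` on the gaps `(log m, log(m+1))`, of
length `≥ 1/M`.  Hence (`IntegerScrewWeilWindowCoerciveComb.sum_sum_zetaScrewKernel_ge_of_coercive` +
the discrete Hardy-type inequality `Σ x_m² ≤ 4 Σ S_m²`):

* `screwWindow_coercive_of_coercive` — if `c·‖F‖₂² ≤ Re Q(F)` on `C(a)` (`0 ≤ c`, `0 < a`), then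
  **`(c/(4M))·Σ_{(N,M]} x_m² ≤ Σ_{(N,M]²} G(log m, log m') x_m x_{m'}`** for every balanced `x` and every
  window with `log M − log(N+1) < 2a`;
* `screwWindow_coercive_bombieri` — with Bombieri's explicit Theorem 12
  (`Bombieri2000Thm12_symmetric`): for `0 < a`, `2a < log 2`, `log M − log(N+1) < 2a`,
  **`((log(1/(2a)) − log⁺log(1/(2a)) − 8)/(4M))·Σ x_m² ≤ Σ G(log m, log m') x_m x_{m'}`** — an RH-FREE
  coercive window floor, uniform in `M`, whose constant GROWS like `¼ log(1/L)` as the window ratio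
  tends to `1` (PIVOT-LAW §16.3 (a): the balanced bottom at ratio `1.004` exceeds the one at ratio `1.5`;
  compare the tree's `IntegerScrewScrewPolyFloorWindowFloor`, ratio `1 + 1/250`, constant `(1 − log 2)/4`).

LABEL: RH-FREE (Bombieri's theorem is unconditional); nothing here bears on the truth of RH — for windows
of ratio `≥ 2` the primes enter and for all windows the statement would be RH.

References: E. Bombieri, Rend. Lincei (9) 11 (2000) §12 Thm. 12 [Bombieri2000Weil]; M. Suzuki, J. Lond.
Math. Soc. (2) 108 (2023) = arXiv:2206.03682, (1.4)–(1.5), Prop. 3.1 [Suzuki2023].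
-/

noncomputable section

-- D-0017: `Summit.<S>.<S>.…` is the designed namespace of a single-problem summit.
set_option linter.dupNamespace false

namespace Summit.RiemannHypothesis.RiemannHypothesis.Theorems.IntegerScrew

open Literature.NumberTheory.LFunctions MeasureTheory Set Finset Filter

/-! ## §1 Bookkeeping: windows as `Fin` families; a discrete Hardy inequality -/

/-- `Σ_{m ∈ (N, M]} f(m) = Σ_{i < M − N} f(N + 1 + i)`. [folklore] -/
theorem sum_Ioc_eq_sum_fin (N M : ℕ) (f : ℕ → ℝ) :
    ∑ m ∈ Ioc N M, f m = ∑ i : Fin (M - N), f (N + 1 + i) := by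
  rw [Fin.sum_univ_eq_sum_range (fun i => f (N + 1 + i)), ← Finset.Ico_add_one_add_one_eq_Ioc,
    Finset.sum_Ico_eq_sum_range, Nat.add_sub_add_right]

/-- **Discrete Hardy-type inequality**: if `Σ_{i<n} yᵢ = 0` then
`Σ_{i<n} yᵢ² ≤ 4 Σ_{k<n} S_k²` with the partial sums `S_k = Σ_{i<k} yᵢ` (`S₀ = S_n = 0`,
`yₖ = S_{k+1} − S_k`, `(A − B)² ≤ 2(A² + B²)`). [folklore] -/
theorem sum_sq_le_four_sum_partial_sq (n : ℕ) (y : ℕ → ℝ) (hy : ∑ i ∈ range n, y i = 0) :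
    ∑ i ∈ range n, y i ^ 2 ≤ 4 * ∑ k ∈ range n, (∑ i ∈ range k, y i) ^ 2 := by
  have hstep : ∀ k, y k = (∑ i ∈ range (k + 1), y i) - ∑ i ∈ range k, y i := fun k => by
    rw [Finset.sum_range_succ]; ring
  have h1 : ∀ k, y k ^ 2 ≤ 2 * ((∑ i ∈ range (k + 1), y i) ^ 2 + (∑ i ∈ range k, y i) ^ 2) := by
    intro k
    rw [hstep k]
    nlinarith [sq_nonneg ((∑ i ∈ range (k + 1), y i) + ∑ i ∈ range k, y i)]
  have h2 : ∑ k ∈ range n, (∑ i ∈ range (k + 1), y i) ^ 2 = ∑ k ∈ range n, (∑ i ∈ range k, y i) ^ 2 := by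
    have e := Finset.sum_range_succ' (fun k => (∑ i ∈ range k, y i) ^ 2) n
    have e2 := Finset.sum_range_succ (fun k => (∑ i ∈ range k, y i) ^ 2) n
    simp only [Finset.sum_range_zero] at e
    rw [hy] at e2
    linarith
  calc ∑ i ∈ range n, y i ^ 2
      ≤ ∑ k ∈ range n, 2 * ((∑ i ∈ range (k + 1), y i) ^ 2 + (∑ i ∈ range k, y i) ^ 2) :=
        Finset.sum_le_sum fun k _ => h1 k
    _ = 2 * (∑ k ∈ range n, (∑ i ∈ range (k + 1), y i) ^ 2
          + ∑ k ∈ range n, (∑ i ∈ range k, y i) ^ 2) := by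
        rw [← Finset.sum_add_distrib, Finset.mul_sum]
    _ = 4 * ∑ k ∈ range n, (∑ i ∈ range k, y i) ^ 2 := by rw [h2]; ring

/-! ## §2 The step energy of a sorted configuration dominates `Σ S_k² · gap_k` -/

/-- On the gap `(T k, T (k+1))` of a strictly increasing node sequence the step function
`Σ_{i<n, T i < t} yᵢ` equals the partial sum `S_{k+1}` (`k + 1 < n`). [folklore] -/
theorem step_eq_partial_sum_of_mem_gap {n : ℕ} (T y : ℕ → ℝ) (hT : StrictMono T) {k : ℕ}
    (hk : k + 1 < n) {t : ℝ} (ht : t ∈ Ioo (T k) (T (k + 1))) :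
    (∑ i : Fin n, if T i < t then y i else 0) = ∑ i ∈ range (k + 1), y i := by
  rw [Fin.sum_univ_eq_sum_range (fun i => if T i < t then y i else 0), ← Finset.sum_filter]
  congr 1
  ext i
  simp only [Finset.mem_filter, Finset.mem_range]
  constructor
  · rintro ⟨-, hi⟩
    by_contra hcon
    have hle : k + 1 ≤ i := not_lt.1 hcon
    have : T (k + 1) ≤ T i := hT.monotone hle
    linarith [ht.2]
  · intro hi
    refine ⟨by omega, ?_⟩
    have : T i ≤ T k := hT.monotone (by omega)
    linarith [ht.1]

/-- **`Σ_{k+1<n} S_{k+1}² (T(k+1) − T k) ≤ ∫_{[−a,a]} P²`** for a strictly increasing node sequence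
inside `[−a, a]`: the gaps are disjoint subintervals on which `P = S_{k+1}`. [folklore] -/
theorem sum_partial_sq_mul_gap_le_integral_step {n : ℕ} (T y : ℕ → ℝ) (hT : StrictMono T) {a : ℝ}
    (h0 : -a ≤ T 0) (hn : T (n - 1) ≤ a) :
    ∑ k ∈ range (n - 1), (∑ i ∈ range (k + 1), y i) ^ 2 * (T (k + 1) - T k) ≤
      ∫ t in Icc (-a) a, (∑ i : Fin n, if T i < t then y i else 0) ^ 2 := by
  set P : ℝ → ℝ := fun t => ∑ i : Fin n, if T i < t then y i else 0 with hP
  -- `P²` is bounded and measurable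
  have hPm : Measurable fun t => P t ^ 2 := (measurable_step (fun i : Fin n => T i) (fun i => y i)).pow_const 2
  have hPb : ∀ t, ‖P t ^ 2‖ ≤ (∑ i : Fin n, |y i|) ^ 2 := by
    intro t
    rw [Real.norm_eq_abs, abs_pow]
    exact pow_le_pow_left₀ (abs_nonneg _) (abs_step_le (fun i : Fin n => T i) (fun i => y i) t) 2
  have hPint : ∀ S : Set ℝ, volume S < ⊤ → IntegrableOn (fun t => P t ^ 2) S := fun S hS =>
    Measure.integrableOn_of_bounded hS.ne hPm.aestronglyMeasurable (Eventually.of_forall hPb)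
  -- each gap carries `S_{k+1}² · gap`
  have hgap : ∀ k ∈ range (n - 1), ∫ t in Ioo (T k) (T (k + 1)), P t ^ 2 =
      (∑ i ∈ range (k + 1), y i) ^ 2 * (T (k + 1) - T k) := by
    intro k hk
    have hk' : k + 1 < n := by have := Finset.mem_range.1 hk; omega
    rw [setIntegral_congr_fun measurableSet_Ioo (fun t ht => by
      show P t ^ 2 = (∑ i ∈ range (k + 1), y i) ^ 2
      rw [hP]; simp only; rw [step_eq_partial_sum_of_mem_gap T y hT hk' ht])]
    rw [setIntegral_const, Measure.real, Real.volume_Ioo,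
      ENNReal.toReal_ofReal (by linarith [hT (Nat.lt_succ_self k)]), smul_eq_mul, mul_comm]
  -- the gaps are disjoint and inside `[−a, a]`
  have hsub : (⋃ k ∈ Finset.range (n - 1), Ioo (T k) (T (k + 1))) ⊆ Icc (-a) a := by
    intro t ht
    simp only [Set.mem_iUnion, Finset.mem_range, exists_prop] at ht
    obtain ⟨k, hk, hkt⟩ := ht
    have h1 : T 0 ≤ T k := hT.monotone (Nat.zero_le k)
    have h2 : T (k + 1) ≤ T (n - 1) := hT.monotone (by omega)
    exact ⟨by linarith [hkt.1], by linarith [hkt.2]⟩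
  have hdisj : Set.Pairwise (↑(Finset.range (n - 1)) : Set ℕ)
      (Function.onFun Disjoint fun k => Ioo (T k) (T (k + 1))) := by
    intro k _ l _ hkl
    rcases lt_or_gt_of_ne hkl with h | h
    · exact Set.disjoint_left.2 fun t ht ht' => by
        have : T (k + 1) ≤ T l := hT.monotone (by omega)
        linarith [ht.2, ht'.1]
    · exact Set.disjoint_left.2 fun t ht ht' => by
        have : T (l + 1) ≤ T k := hT.monotone (by omega)
        linarith [ht.1, ht'.2]
  calc ∑ k ∈ range (n - 1), (∑ i ∈ range (k + 1), y i) ^ 2 * (T (k + 1) - T k)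
      = ∑ k ∈ range (n - 1), ∫ t in Ioo (T k) (T (k + 1)), P t ^ 2 :=
        Finset.sum_congr rfl fun k hk => (hgap k hk).symm
    _ = ∫ t in ⋃ k ∈ Finset.range (n - 1), Ioo (T k) (T (k + 1)), P t ^ 2 :=
        (integral_biUnion_finset (Finset.range (n - 1)) (fun k _ => measurableSet_Ioo) hdisj
          (fun k _ => hPint _ (by rw [Real.volume_Ioo]; exact ENNReal.ofReal_lt_top))).symm
    _ ≤ ∫ t in Icc (-a) a, P t ^ 2 :=
        setIntegral_mono_set (hPint _ measure_Icc_lt_top)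
          (Eventually.of_forall fun t => sq_nonneg _) (Eventually.of_forall hsub)

/-! ## §3 The coercive floor on balanced integer windows -/

/-- **COERCIVE WINDOW FLOOR FROM `L²`-COERCIVITY** (RH-FREE glue): if `c·‖F‖₂² ≤ Re Q(F)` for all test
functions supported in `[−a, a]` (`0 < a`, `0 ≤ c`), then for all `N, M` with
`log M − log(N+1) < 2a` and every real `x` with `Σ_{(N,M]} x_m = 0`,
`(c/(4M))·Σ_{(N,M]} x_m² ≤ Σ_{m,m'∈(N,M]} G(log m, log m') x_m x_{m'}`.  (Recentre the nodes at the
midpoint; coercive comb transfer; the step function is `S_m` on `(log m, log(m+1))`, gaps `≥ 1/M`;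
discrete Hardy.) [cite: Suzuki2023, (1.4)–(1.5) and Prop 3.1] -/
theorem screwWindow_coercive_of_coercive {a c : ℝ} (ha : 0 < a) (hc : 0 ≤ c)
    (hcoer : ∀ F : ℝ → ℂ, IsWeilTest F → tsupport F ⊆ Icc (-a) a →
      c * ∫ t, ‖F t‖ ^ 2 ≤ (weilQuadratic F).re)
    (N M : ℕ) (hNM : Real.log M - Real.log ((N : ℝ) + 1) < 2 * a) (x : ℕ → ℝ)
    (hx : ∑ m ∈ Ioc N M, x m = 0) :
    c / (4 * M) * ∑ m ∈ Ioc N M, x m ^ 2 ≤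
      ∑ m ∈ Ioc N M, ∑ m' ∈ Ioc N M,
        zetaScrewKernel (Real.log m) (Real.log m') * (x m * x m') := by
  rcases le_or_gt M N with hMN | hMN
  · simp [Finset.Ioc_eq_empty_of_le hMN]
  -- the window as a `Fin n` family, `n = M − N ≥ 1`, recentred at the midpoint `c₀`
  set n : ℕ := M - N with hn
  have hn1 : 1 ≤ n := by omega
  have hN1 : (0 : ℝ) < (N : ℝ) + 1 := by positivity
  have hMpos : (0 : ℝ) < M := hN1.trans_le (by exact_mod_cast hMN)
  set c₀ : ℝ := (Real.log ((N : ℝ) + 1) + Real.log M) / 2 with hc₀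
  set T : ℕ → ℝ := fun k => Real.log ((N : ℝ) + 1 + k) - c₀ with hT
  set y : ℕ → ℝ := fun k => x (N + 1 + k) with hy
  have hTmono : StrictMono T := by
    intro k l hkl
    simp only [hT]
    have : Real.log ((N : ℝ) + 1 + k) < Real.log ((N : ℝ) + 1 + l) :=
      Real.log_lt_log (by positivity) (by exact_mod_cast Nat.add_lt_add_left hkl (N + 1))
    linarith
  -- all nodes lie in `(−a, a)`
  have hTabs : ∀ k, k < n → |T k| < a := by
    intro k hk
    have hk1 : (N : ℝ) + 1 ≤ (N : ℝ) + 1 + k := by simp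
    have hk2 : (N : ℝ) + 1 + k ≤ M := by
      have : N + 1 + k ≤ M := by omega
      exact_mod_cast this
    have hl1 : Real.log ((N : ℝ) + 1) ≤ Real.log ((N : ℝ) + 1 + k) := Real.log_le_log hN1 hk1
    have hl2 : Real.log ((N : ℝ) + 1 + k) ≤ Real.log M := Real.log_le_log (by positivity) hk2
    rw [abs_lt]; constructor <;> · simp only [hT, hc₀]; linarith
  -- the zero-sum `Fin n` system and the coercive comb transfer
  have hsumy : ∑ i : Fin n, y i = 0 := by
    rw [← hx, sum_Ioc_eq_sum_fin]
  have key := sum_sum_zetaScrewKernel_ge_of_coercive ha hc hcoer (fun i : Fin n => T i)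
    (fun i : Fin n => y i) (fun i => hTabs i i.2) hsumy
  -- right side: the window form (balanced forms ignore the recentring)
  have hform : ∑ i : Fin n, ∑ j : Fin n, y i * y j * zetaScrewKernel (T i) (T j) =
      ∑ m ∈ Ioc N M, ∑ m' ∈ Ioc N M,
        zetaScrewKernel (Real.log m) (Real.log m') * (x m * x m') := by
    have e1 : ∑ i : Fin n, ∑ j : Fin n, y i * y j * zetaScrewKernel (T i) (T j) =
        ∑ i : Fin n, ∑ j : Fin n,
          zetaScrewKernel (Real.log ((N : ℝ) + 1 + (i : ℕ)) + (-c₀))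
            (Real.log ((N : ℝ) + 1 + (j : ℕ)) + (-c₀)) * (y i * y j) :=
      Finset.sum_congr rfl fun i _ => Finset.sum_congr rfl fun j _ => by
        simp only [hT, sub_eq_add_neg]; ring
    rw [e1, screwForm_add_const_of_sum_eq_zero (fun i : Fin n => Real.log ((N : ℝ) + 1 + (i : ℕ)))
      (fun i : Fin n => y i) _ hsumy]
    rw [sum_Ioc_eq_sum_fin]
    refine Finset.sum_congr rfl fun i _ => ?_
    rw [sum_Ioc_eq_sum_fin]
    refine Finset.sum_congr rfl fun j _ => ?_
    simp only [hy]
    push_cast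
    ring_nf
  -- left side: step energy ≥ (1/M)·Σ S_k² ≥ Σ x²/(4M)
  have hgap : ∀ k ∈ range (n - 1), (1 : ℝ) / M ≤ T (k + 1) - T k := by
    intro k hk
    have hk' : k + 1 < n := by have := Finset.mem_range.1 hk; omega
    have hpos : (0 : ℝ) < (N : ℝ) + 1 + k := by positivity
    have hq : (0 : ℝ) < ((N : ℝ) + 1 + (k + 1 : ℕ)) / ((N : ℝ) + 1 + k) := by positivity
    have h1 := Real.one_sub_inv_le_log_of_pos hq
    rw [Real.log_div (by positivity) hpos.ne', inv_div] at h1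
    have h2 : (1 : ℝ) - ((N : ℝ) + 1 + k) / ((N : ℝ) + 1 + (k + 1 : ℕ)) =
        1 / ((N : ℝ) + 1 + (k + 1 : ℕ)) := by
      field_simp; push_cast; ring
    have h3 : (1 : ℝ) / M ≤ 1 / ((N : ℝ) + 1 + (k + 1 : ℕ)) := by
      apply one_div_le_one_div_of_le (by positivity)
      have : N + 1 + (k + 1) ≤ M := by omega
      exact_mod_cast this
    simp only [hT]
    linarith
  have hS0 : T 0 = Real.log ((N : ℝ) + 1) - c₀ := by simp [hT]
  have hlow := sum_partial_sq_mul_gap_le_integral_step (n := n) T y hTmono (a := a)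
    (by have := hTabs 0 (by omega); rw [abs_lt] at this; linarith [this.1])
    (by have := hTabs (n - 1) (by omega); rw [abs_lt] at this; linarith [this.2])
  have hstep1 : (1 : ℝ) / M * ∑ k ∈ range (n - 1), (∑ i ∈ range (k + 1), y i) ^ 2 ≤
      ∑ k ∈ range (n - 1), (∑ i ∈ range (k + 1), y i) ^ 2 * (T (k + 1) - T k) := by
    rw [Finset.mul_sum]
    exact Finset.sum_le_sum fun k hk => by
      rw [mul_comm]
      exact mul_le_mul_of_nonneg_left (hgap k hk) (sq_nonneg _)
  -- `Σ_{k<n−1} S_{k+1}² = Σ_{k<n} S_k²` (`S₀ = 0`)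
  have hshift : ∑ k ∈ range (n - 1), (∑ i ∈ range (k + 1), y i) ^ 2 =
      ∑ k ∈ range n, (∑ i ∈ range k, y i) ^ 2 := by
    have e := Finset.sum_range_succ' (fun k => (∑ i ∈ range k, y i) ^ 2) (n - 1)
    rw [Nat.sub_add_cancel hn1] at e
    rw [e]
    simp
  have hsumy' : ∑ i ∈ range n, y i = 0 := by
    rw [← Fin.sum_univ_eq_sum_range]; exact hsumy
  have hhardy := sum_sq_le_four_sum_partial_sq n y hsumy'
  have hx2 : ∑ m ∈ Ioc N M, x m ^ 2 = ∑ i ∈ range n, y i ^ 2 := by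
    rw [sum_Ioc_eq_sum_fin, ← Fin.sum_univ_eq_sum_range (fun i => y i ^ 2)]
  -- assemble
  rw [← hform, hx2]
  have hM4 : (0 : ℝ) < 4 * M := by positivity
  calc c / (4 * M) * ∑ i ∈ range n, y i ^ 2
      ≤ c / (4 * M) * (4 * ∑ k ∈ range n, (∑ i ∈ range k, y i) ^ 2) :=
        mul_le_mul_of_nonneg_left hhardy (div_nonneg hc hM4.le)
    _ = c * ((1 : ℝ) / M * ∑ k ∈ range (n - 1), (∑ i ∈ range (k + 1), y i) ^ 2) := by
        rw [hshift]; field_simp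
    _ ≤ c * ∫ t in Icc (-a) a, (∑ i : Fin n, if T i < t then y i else 0) ^ 2 :=
        mul_le_mul_of_nonneg_left (hstep1.trans hlow) hc
    _ ≤ ∑ i : Fin n, ∑ j : Fin n, y i * y j * zetaScrewKernel (T i) (T j) := key

/-- **BOMBIERI'S THEOREM 12 ON THE INTEGER SCREW MATRICES** (RH-FREE, effective): for `0 < a`,
`2a < log 2`, every window `(N, M]` with `log M − log(N+1) < 2a` and every balanced real `x`,
`((log(1/(2a)) − log⁺log(1/(2a)) − 8)/(4M))·Σ_{(N,M]} x_m² ≤ Σ_{(N,M]²} G(log m, log m') x_m x_{m'}`: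
a coercive floor uniform in `M` whose constant grows like `¼·log(1/L)` as the window's log-length `L`
shrinks (when the constant is negative the inequality is plain positivity, Yoshida). [cite: Bombieri2000Weil, §12 Thm. 12] -/
theorem screwWindow_coercive_bombieri {a : ℝ} (ha : 0 < a) (h2a : 2 * a < Real.log 2) (N M : ℕ)
    (hNM : Real.log M - Real.log ((N : ℝ) + 1) < 2 * a) (x : ℕ → ℝ)
    (hx : ∑ m ∈ Ioc N M, x m = 0) :
    (Real.log (1 / (2 * a)) - Real.posLog (Real.log (1 / (2 * a))) - 8) / (4 * M) *
        ∑ m ∈ Ioc N M, x m ^ 2 ≤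
      ∑ m ∈ Ioc N M, ∑ m' ∈ Ioc N M,
        zetaScrewKernel (Real.log m) (Real.log m') * (x m * x m') := by
  set c : ℝ := Real.log (1 / (2 * a)) - Real.posLog (Real.log (1 / (2 * a))) - 8 with hc
  rcases le_or_gt 0 c with hc0 | hc0
  · exact screwWindow_coercive_of_coercive ha hc0
      (fun F hF hsupp => Bombieri2000Thm12_symmetric hF ha h2a hsupp) N M hNM x hx
  · have hW : WeilPositivityOn a := weilPositivityOn_of_le_log_two_half (by linarith)
    have hpos := screwWindow_nonneg_of_weilPositivityOn hW N M hNM x hx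
    have hsq : 0 ≤ ∑ m ∈ Ioc N M, x m ^ 2 := Finset.sum_nonneg fun m _ => sq_nonneg _
    have hcM : c / (4 * M) * ∑ m ∈ Ioc N M, x m ^ 2 ≤ 0 := by
      rcases Nat.eq_zero_or_pos M with hM | hM
      · simp [hM]
      · exact mul_nonpos_of_nonpos_of_nonneg
          (div_nonpos_of_nonpos_of_nonneg hc0.le (by positivity)) hsq
    linarith

/-- **TOP-`K` BLOCKS OF SUZUKI'S MATRICES ARE COERCIVE ON BALANCED VECTORS, WITH A LOGARITHMICALLY
GROWING MARGIN** (RH-FREE, effective; `a = K/M` in `screwWindow_coercive_bombieri`): for `1 ≤ K`,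
`2K ≤ M` and `2K/M < log 2`, every real `x` balanced on the top window `(M − K, M]` satisfies
`((log(M/(2K)) − log⁺log(M/(2K)) − 8)/(4M))·Σ x_m² ≤ Σ G(log m, log m') x_m x_{m'}` — for fixed `K`
the balanced bottom of the top `K × K` corner of `S_M` is `≥ (¼ log M − ¼ log log M − O_K(1))/M`.
[cite: Bombieri2000Weil, §12 Thm. 12] -/
theorem screwWindow_top_coercive (K M : ℕ) (hK : 1 ≤ K) (hKM : 2 * K ≤ M)
    (hlog : 2 * (K : ℝ) / M < Real.log 2) (x : ℕ → ℝ) (hx : ∑ m ∈ Ioc (M - K) M, x m = 0) :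
    (Real.log ((M : ℝ) / (2 * K)) - Real.posLog (Real.log ((M : ℝ) / (2 * K))) - 8) / (4 * M) *
        ∑ m ∈ Ioc (M - K) M, x m ^ 2 ≤
      ∑ m ∈ Ioc (M - K) M, ∑ m' ∈ Ioc (M - K) M,
        zetaScrewKernel (Real.log m) (Real.log m') * (x m * x m') := by
  have hKr : (1 : ℝ) ≤ K := by exact_mod_cast hK
  have hMr : 2 * (K : ℝ) ≤ M := by exact_mod_cast hKM
  have hMpos : (0 : ℝ) < M := by linarith
  have ha : (0 : ℝ) < K / M := by positivity
  have h2a : 2 * ((K : ℝ) / M) < Real.log 2 := by rwa [← mul_div_assoc]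
  have e : (1 : ℝ) / (2 * ((K : ℝ) / M)) = (M : ℝ) / (2 * K) := by
    field_simp
  have key := screwWindow_coercive_bombieri ha h2a (M - K) M ?_ x hx
  · rwa [e] at key
  -- the window condition `log M − log(M − K + 1) < 2K/M`
  have hcast : ((M - K : ℕ) : ℝ) + 1 = (M : ℝ) - K + 1 := by
    rw [Nat.cast_sub (by omega)]
  rw [hcast]
  have hpos : (0 : ℝ) < (M : ℝ) - K + 1 := by linarith
  have h1 : Real.log M - Real.log ((M : ℝ) - K + 1) ≤ (M : ℝ) / ((M : ℝ) - K + 1) - 1 := by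
    rw [← Real.log_div hMpos.ne' hpos.ne']
    exact Real.log_le_sub_one_of_pos (by positivity)
  have h2 : (M : ℝ) / ((M : ℝ) - K + 1) - 1 = ((K : ℝ) - 1) / ((M : ℝ) - K + 1) := by
    field_simp
    ring
  have h3 : ((K : ℝ) - 1) / ((M : ℝ) - K + 1) ≤ ((K : ℝ) - 1) * (2 / M) := by
    rw [div_eq_mul_one_div]
    apply mul_le_mul_of_nonneg_left _ (by linarith)
    rw [div_le_div_iff₀ hpos hMpos]
    linarith
  have h4 : ((K : ℝ) - 1) * (2 / M) < 2 * ((K : ℝ) / M) := by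
    have e2 : ((K : ℝ) - 1) * (2 / M) = 2 * ((K : ℝ) / M) - 2 / M := by ring
    rw [e2]
    have : (0 : ℝ) < 2 / M := by positivity
    linarith
  linarith

end Summit.RiemannHypothesis.RiemannHypothesis.Theorems.IntegerScrew

end
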